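import Summits.Ventures.Crystal3D.Theorems.StickyWulffConstantNoReconstructionGainFourFamilyOrbit
import Summits.Ventures.Crystal3D.Theorems.StickyWulffConstantNoReconstructionGainThirdLatticeCoverB
import HarnessLib

/-!
# Every film on the refined lattice `(1/3)Λ₀` satisfies the atom — every unit normal, no exception

HONEST FRAMING. Part of the venture `Summits/Ventures/Crystal3D` (cell `crystal3d-full`), helper
`--supports` the crux `NoReconstructionGain` (stmt-Ventures-19144, route
`route-Ventures-StickyWulffConstant`), line `adhesion`; closes census class (ii) outright:
`fourFamilyBarlowFilm_slab_orbit` (the certificate in any cone `⟪g hᵢ, ν⟫ ≤ 0`) +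
`exists_latticeIso_sorting` (for every `ν` some lattice isometry `g` puts `ν` in the cone).

* `thirdLatticeFilm_slab` (**rung**, registered by name): there are `R = 2`, `C = 18432` such that for
  EVERY unit normal `ν`, every `ρ ≥ R` and every finite unit packing `X ⊇ P` (`P` the `ν`-slab sample
  of the fcc lattice, thickness `R`, lateral radius `ρ`) whose other balls all lie on the refined
  lattice `(1/3)Λ₀` (this contains the Barlow positions of all four `{111}` families: every mixture
  of fcc continuation, twin lamellae, hcp / stacking faults and islands on all four families at
  once) and above the cut: `#cross(P, X ∖ P) ≤ contactDeficiency (X ∖ P) + C ρ`.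

WHAT THIS IS NOT: films off the refined lattice (rotated grains, amorphous adsorbates) — the crux
proper; rung F-C1 not moved.
-/

noncomputable section

namespace Summit.Ventures.Crystal3D.Theorems

open Summit.Ventures.Crystal3D Finset
open Literature.MathematicalPhysics.StatisticalMechanics (barlowPos fccStacking barlowOffset layerNormal constHagg
  contactDeficiency)
open scoped InnerProductSpace

/-- **Films on the refined lattice `(1/3)Λ₀`, every unit normal** (registered by name): the
adhesion inequality of the crux holds with `R = 2`, `C = 18432` for every film whose balls lie in
`(1/3)Λ₀`, above the cut. -/
theorem thirdLatticeFilm_slab :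
    ∃ R C : ℝ, 1 ≤ R ∧ ∀ ν : EuclideanSpace ℝ (Fin 3), ‖ν‖ = 1 → ∀ ρ : ℝ, R ≤ ρ →
      ∀ X P : Finset (EuclideanSpace ℝ (Fin 3)),
      (∀ p ∈ X, ∀ q ∈ X, p ≠ q → 1 ≤ dist p q) → P ⊆ X →
      (∀ p, p ∈ P ↔ (p ∈ fccStacking 1 (Real.sqrt (2 / 3)) ∧ -(2 * R) ≤ ⟪p, ν⟫_ℝ ∧
        ⟪p, ν⟫_ℝ ≤ -R ∧ ‖p‖ ^ 2 - ⟪p, ν⟫_ℝ ^ 2 ≤ ρ ^ 2)) →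
      (∀ q ∈ X \ P, ∃ K I J : ℤ, q = (1 / 3 : ℝ) • barlowPos 1 (Real.sqrt (2 / 3)) constHagg K I J) →
      (∀ q ∈ X \ P, -R < ⟪q, ν⟫_ℝ) →
      ((((P ×ˢ (X \ P)).filter fun pq => dist pq.1 pq.2 = 1).card : ℕ) : ℝ) ≤
        contactDeficiency (X \ P) + C * ρ := by
  obtain ⟨R, C, hR, h⟩ := fourFamilyBarlowFilm_slab_orbit
  refine ⟨R, C, hR, fun ν hν ρ hρ X P hX hPX hP hfilm habove => ?_⟩
  obtain ⟨g, hg, hg', hcone⟩ := exists_latticeIso_sorting ν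
  exact h ν hν ρ hρ X P hX hPX hP g hg hg' hcone hfilm habove

end Summit.Ventures.Crystal3D.Theorems

end
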